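import Literature.AlgebraicGeometry.HodgeTheory.HodgeLocus
import Literature.AlgebraicGeometry.Motives.AlgPointsProofs
import Literature.FieldTheory.AlgClosed.AutomorphismExtension
import Mathlib.Algebra.MvPolynomial.Cardinal
import Mathlib.RingTheory.Localization.Cardinality
import Mathlib.FieldTheory.IsAlgClosed.AlgebraicClosure
import Mathlib.Algebra.Algebra.Hom.Rat
import Mathlib.FieldTheory.AlgebraicClosure
import HarnessLib

/-!
# Complex points over the same point of a `K`-scheme are conjugate under `Aut(ℂ/K)`; `k₀`-closed sets are saturated (Lang, *Introduction to Algebraic Geometry*, III §4–§5)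

Topic `Literature/AlgebraicGeometry/HodgeTheory` (family `hodge`), a proofs-only companion of
`HodgeLocus.lean` (Weil's `k₀`-closed sets `IsDefinedOver σ S₀ k₀ Z`, `IsDefinedOverQbar`, the
conjugation `conjPoint σ S₀ τ` of complex points of `S = S₀ ⊗_{K,σ} ℂ` by `τ ∈ Aut(ℂ/σK)`) on the
real carriers of `Motives/AlgPoints` (`L`-points `Motives.AlgPoints X L`, their underlying points
`pt`, residue-field embeddings `resHom`, values `eval`, and the Galois action `τ • P = Spec τ ≫ P`).
Everything is PROVED; no definitions, no named facts.

* `Motives.AlgPoints.exists_smul_eq_of_pt_eq` — **complex points with the same underlying point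
  are conjugate**: for `ℂ` a `K`-algebra with `K` countable and `X` a `K`-scheme locally of finite
  type, two points `Q, Q' ∈ X(ℂ)` with `Q.pt = Q'.pt = x` satisfy `Q' = τ • Q` for some
  `τ : ℂ ≃ₐ[K] ℂ`. Proof: `Q, Q'` are the pairs `(x, e)`, `(x, e')` of embeddings
  `e, e' : κ(x) → ℂ` (Mathlib `Scheme.SpecToEquivOfField`) which agree with `algebraMap K ℂ` on the
  constants (`Motives.AlgPoints.eval_appTop_algebraMap`); `κ(x)` is countable
  (`Motives.cardinalMk_residueField_le_aleph0`), so `e' = ρ ∘ e` for an automorphism `ρ` of `ℂ`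
  (the tree's `Literature.FieldTheory.AlgClosed.exists_ringEquiv_apply_eq`: Lang, *Algebra*,
  VIII §1), which is then `K`-linear, and `τ • Q` is the pair `(x, τ ∘ e)`
  (`Motives.AlgPoints.specToEquivOfField_smul`). This is the scheme-theoretic content of Lang's
  "complete set of conjugates of a point over `k`" (III §4) and of Charles–Schnell's remark that a
  complex point of `S_ℂ` over the generic point is "induced by an embedding of `k(S)` in `ℂ`"
  (Lemma 11.3.14).
* `exists_conjPoint_eq_of_base_pt_eq` — the same through `S(ℂ) ≃ S₀(ℂ)`: complex points of
  `S = S₀ ⊗_σ ℂ` over the same point of `S₀` are `conjPoint`-conjugate.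
* `IsDefinedOver.mem_of_base_pt_eq`, `IsDefinedOverQbar.mem_of_base_pt_eq` — **`k₀`-closed sets
  are saturated for `S(ℂ) → S₀`** when `k₀ ⊆ σ(K)` (e.g. `k₀ = ℚ̄ ⊆ ℂ`, `K = AlgebraicClosure ℚ`:
  every embedding `ℚ̄ →+* ℂ` is onto the algebraic numbers, `algebraicClosure_le_fieldRange`): a
  `k₀`-closed `Z ∋ s` contains every complex point over the point of `S₀` under `s` ("`A`
  contains, with a point, all its conjugates": Lang III §5, C4).
* Auxiliary: `Motives.AlgPoints.eval_appTop_algebraMap` (the value of the constant `a ∈ K` at an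
  `L`-point is `algebraMap K L a`), `Motives.cardinalMk_residueField_le_aleph0` (residue fields of
  a scheme locally of finite type over a countable field are countable),
  `exists_apply_eq_of_isAlgebraic` / `algebraicClosure_le_fieldRange` /
  `cardinalMk_algebraicClosure_rat_le_aleph0` (`σ(ℚ̄)` is the field of algebraic numbers; `ℚ̄` is
  countable).

Use: with `AlgebraicityLocus.lean` (a `ℚ̄`-GENERIC `s ∈ S(ℂ)` — every `ℚ̄`-closed `Z ∋ s` is all of
`S(ℂ)`, the hypothesis of `HodgeLocusPropagation` in route `HodgeConjecture/PadicSemiregularLift` —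
lies over the generic point of `S₀`), these lemmas are the first half of the converse: a `ℚ̄`-closed
set through ONE point over the generic point `η` contains ALL complex points over `η`. NOT here:
the second half (the complex points over `η` are Zariski dense in `S`, equivalently Lang's
C4 ⇒ C7: a Galois-stable Zariski-closed set of complex points is `W(ℂ)` for a closed `W ⊆ S₀`).

Mathlib searched (pin v4.32.0): `Scheme.SpecToEquivOfField(_eq_iff)`, `Scheme.residueFieldCongr`,
`IsAffineOpen.isLocalization_stalk`, `IsLocalization.cardinalMk_le`, `Scheme.residue_surjective`,
`Algebra.IsAlgebraic.algHom_bijective`, `algebraicClosure.isAlgClosure`, `RingHom.toRatAlgHom`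
(all used); Mathlib has no statement on conjugacy of `L`-points.

## References

* [Lang1958IAG] S. Lang, Introduction to Algebraic Geometry (1958), Ch. III §4 (conjugates of a
  point, `k`-closed sets) and §5 (C4–C7).
* [CharlesSchnell2014Notes] F. Charles, C. Schnell, Notes on absolute Hodge classes (2014), §11.3.4
  (before Prop. 11.3.13: "The class `α_s` only depends on the complex point `s`") and Lemma 11.3.14.
* S. Lang, Algebra, rev. 3rd ed. (2002), Ch. VIII §1 (transcendence bases; through the tree's
  `FieldTheory/AlgClosed/AutomorphismExtension`).
-/

noncomputable section

open CategoryTheory AlgebraicGeometry Cardinal _root_.Topology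

universe u

namespace Literature.AlgebraicGeometry.HodgeTheory

section HodgeTheory

/-! ### Countability of residue fields -/

/-- Transport of `Scheme.evaluation` along an equality of points (Mathlib
`Scheme.residueFieldCongr`). [folklore] -/
theorem residueFieldCongr_hom_evaluation {Y : Scheme.{u}} (U : Y.Opens) {x y : Y}
    (e : x = y) (h : x ∈ U) (f : Γ(Y, U)) :
    (Y.residueFieldCongr e).hom (Y.evaluation U x h f) = Y.evaluation U y (e ▸ h) f := by
  subst e
  rfl

/-- **Residue fields of a scheme locally of finite type over a countable field are countable**:
`κ(y)` is a quotient of the local ring `𝒪_{Y,y}`, a localization of the coordinate ring of an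
affine neighbourhood, itself a quotient of a polynomial ring in finitely many variables over the
countable field. [folklore] -/
theorem cardinalMk_residueField_le_aleph0 {K : Type u} [Field K] (Y : Scheme.{u})
    (f : Y ⟶ Spec (.of K)) [LocallyOfFiniteType f] (hK : #K ≤ ℵ₀) (y : Y) :
    #(Y.residueField y) ≤ ℵ₀ := by
  obtain ⟨_, ⟨U, hU, rfl⟩, hyU, -⟩ :=
    Y.isBasis_affineOpens.exists_subset_of_mem_open (Set.mem_univ y) isOpen_univ
  have hU : IsAffineOpen U := hU
  -- the coordinate ring `Γ(Y, U)` is countable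
  let ι : K →+* Γ(Spec (CommRingCat.of K), ⊤) := (Scheme.ΓSpecIso (CommRingCat.of K)).inv.hom
  letI algU : Algebra K Γ(Y, U) := ((f.appLE ⊤ U le_top).hom.comp ι).toAlgebra
  haveI : Algebra.FiniteType K Γ(Y, U) := by
    have h1 : (f.appLE ⊤ U le_top).hom.FiniteType :=
      f.finiteType_appLE (isAffineOpen_top _) hU le_top
    have h2 : ι.FiniteType :=
      RingHom.FiniteType.of_surjective _
        (Scheme.ΓSpecIso (CommRingCat.of K)).symm.commRingCatIsoToRingEquiv.surjective
    exact h1.comp h2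
  obtain ⟨n, g, hg⟩ :=
    Algebra.FiniteType.iff_quotient_mvPolynomial''.mp ‹Algebra.FiniteType K Γ(Y, U)›
  have hΓ : #Γ(Y, U) ≤ ℵ₀ := by
    refine (Cardinal.mk_le_of_surjective hg).trans (MvPolynomial.cardinalMk_le_max_lift.trans ?_)
    refine max_le (max_le ?_ ?_) le_rfl
    · simpa using hK
    · simp
  -- the local ring is a localization of `Γ(Y, U)`, and `κ(y)` a quotient of the local ring
  letI := Y.presheaf.algebra_section_stalk ⟨y, hyU⟩
  haveI := hU.isLocalization_stalk ⟨y, hyU⟩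
  have hst : #(Y.presheaf.stalk y) ≤ ℵ₀ :=
    (IsLocalization.cardinalMk_le (L := Y.presheaf.stalk y)
      (hU.primeIdealOf ⟨y, hyU⟩).asIdeal.primeCompl).trans hΓ
  exact (Cardinal.mk_le_of_surjective (Y.residue_surjective y)).trans hst

/-! ### Conjugacy of `L`-points (dot-notation extensions of `Motives.AlgPoints`, declared with absolute names) -/

section AlgPoints

open Literature.AlgebraicGeometry.Motives

variable {k : Type u} [Field k] {X : SchemeOver k} {L : Type u} [Field L] [Algebra k L]

/-- **The value of a constant is the constant**: for `a ∈ k`, the regular function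
`a ∈ Γ(X, 𝒪_X)` (image of `a` under the structure map) takes the value `algebraMap k L a` at every
`L`-point (`P^* ∘ (X → Spec k)^* = (Spec L → Spec k)^*`). [folklore] -/
theorem _root_.Literature.AlgebraicGeometry.Motives.AlgPoints.eval_appTop_algebraMap
    (P : AlgPoints X L) (a : k) :
    P.eval ⊤ trivial (X.hom.appTop ((Scheme.ΓSpecIso (.of k)).inv a)) = algebraMap k L a := by
  have key : ∀ (g : Spec (.of L) ⟶ Spec (.of k)) (e : (⊤ : (Spec (.of L)).Opens) ≤ g ⁻¹ᵁ ⊤),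
      g = Spec.map (CommRingCat.ofHom (algebraMap k L)) →
      (Scheme.ΓSpecIso (.of L)).hom (g.appLE ⊤ ⊤ e ((Scheme.ΓSpecIso (.of k)).inv a)) =
        algebraMap k L a := by
    rintro g e rfl
    rw [AlgPoints.ΓSpecIso_hom_SpecMap_appLE_top]
    change algebraMap k L ((Scheme.ΓSpecIso (.of k)).hom ((Scheme.ΓSpecIso (.of k)).inv a)) = _
    rw [Iso.inv_hom_id_apply]
  rw [AlgPoints.eval_eq_appLE]
  have h1 : P.left.appLE ⊤ ⊤ (P.preimage_eq_top (U := ⊤) trivial).ge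
      (X.hom.appTop ((Scheme.ΓSpecIso (.of k)).inv a)) =
      (P.left ≫ X.hom).appLE ⊤ ⊤ le_top ((Scheme.ΓSpecIso (.of k)).inv a) := by
    rw [Scheme.Hom.comp_appLE (V := ⊤)]
    rfl
  rw [h1]
  exact key _ _ (Over.w P)

/-- **Complex points over the same point are conjugate.** Let `ℂ` be a `K`-algebra (through an
embedding `σ : K →+* ℂ`) with `K` countable (e.g. a number field or `ℚ̄`), `X` a `K`-scheme
locally of finite type, and `Q, Q' ∈ X(ℂ)` two complex points with the same underlying point
`x ∈ X`. Then
`Q' = τ · Q` for an automorphism `τ` of `ℂ` over `K`: the two embeddings `κ(x) → ℂ` defined by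
`Q, Q'` agree on `K` and, `κ(x)` being countable, differ by an automorphism of `ℂ` (Lang,
*Algebra* VIII §1: transcendence bases; the tree's `exists_ringEquiv_apply_eq`), which is then
`K`-linear. This is the fact behind "a complete set of conjugates of `x` over `k`" (Lang,
*Introduction to Algebraic Geometry*, III §4) and behind Charles–Schnell's "the class `α_s` only
depends on the complex point `s`" / Lemma 11.3.14. [cite: Lang1958IAG, Ch. III §4] -/
theorem _root_.Literature.AlgebraicGeometry.Motives.AlgPoints.exists_smul_eq_of_pt_eq
    {K : Type} [Field K] [Algebra K ℂ] (hK : #K ≤ ℵ₀)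
    {X : SchemeOver K} [LocallyOfFiniteType X.hom] (Q Q' : AlgPoints X ℂ) (h : Q'.pt = Q.pt) :
    ∃ τ : ℂ ≃ₐ[K] ℂ, τ • Q = Q' := by
  -- the two embeddings of `κ(x)`, `x = Q.pt`
  set e : X.left.residueField Q.pt ⟶ .of ℂ := Q.resHom with he
  set e' : X.left.residueField Q.pt ⟶ .of ℂ := (X.left.residueFieldCongr h.symm).hom ≫ Q'.resHom
    with he'
  -- the constants: `c a ∈ κ(x)` for `a ∈ K`, with `e (c a) = a = e' (c a)` in `ℂ`
  let c : K → X.left.residueField Q.pt := fun a =>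
    X.left.evaluation ⊤ Q.pt trivial (X.hom.appTop ((Scheme.ΓSpecIso (.of K)).inv a))
  have hec : ∀ a, e (c a) = algebraMap K ℂ a := fun a => Q.eval_appTop_algebraMap a
  have he'c : ∀ a, e' (c a) = algebraMap K ℂ a := by
    intro a
    change Q'.resHom ((X.left.residueFieldCongr h.symm).hom (X.left.evaluation ⊤ Q.pt trivial _)) = _
    rw [residueFieldCongr_hom_evaluation]
    exact Q'.eval_appTop_algebraMap a
  -- an automorphism `ρ` of `ℂ` with `ρ ∘ e = e'`
  have hΩ : ℵ₀ < #ℂ := by rw [Cardinal.mk_complex]; exact Cardinal.aleph0_lt_continuum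
  have hκ : #(X.left.residueField Q.pt) ≤ ℵ₀ := cardinalMk_residueField_le_aleph0 X.left X.hom hK _
  obtain ⟨ρ, hρ⟩ :=
    Literature.FieldTheory.AlgClosed.exists_ringEquiv_apply_eq hΩ hκ e.hom e'.hom
  -- `ρ` is `K`-linear
  have hρK : ∀ a : K, ρ (algebraMap K ℂ a) = algebraMap K ℂ a := fun a =>
    calc ρ (algebraMap K ℂ a) = ρ (e (c a)) := by rw [hec]
      _ = e' (c a) := hρ _
      _ = algebraMap K ℂ a := he'c a
  let τ : ℂ ≃ₐ[K] ℂ := { ρ with commutes' := hρK }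
  refine ⟨τ, ?_⟩
  -- compare the pairs (point, embedding)
  apply Over.OverMorphism.ext
  apply (X.left.SpecToEquivOfField ℂ).injective
  rw [AlgPoints.specToEquivOfField_smul]
  change (⟨Q.pt, Q.resHom ≫ CommRingCat.ofHom (ρ : ℂ →+* ℂ)⟩ :
      Σ x : X.left, X.left.residueField x ⟶ .of ℂ) = ⟨Q'.pt, Q'.resHom⟩
  rw [Scheme.SpecToEquivOfField_eq_iff]
  refine ⟨h.symm, ?_⟩
  ext z
  exact hρ z

end AlgPoints

/-! ### The image of `ℚ̄` in `ℂ` is the field of algebraic numbers -/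

/-- **Every algebraic complex number lies in the image of any embedding `σ : ℚ̄ →+* ℂ`**
(`ℚ̄ = AlgebraicClosure ℚ`): `σ` corestricts to a `ℚ`-embedding of `ℚ̄` into the algebraic
closure `algebraicClosure ℚ ℂ` of `ℚ` in `ℂ`, and a `ℚ`-embedding between two algebraic closures
of `ℚ` is onto (Mathlib `Algebra.IsAlgebraic.algHom_bijective`). [folklore] -/
theorem exists_apply_eq_of_isAlgebraic (σ : AlgebraicClosure ℚ →+* ℂ) {z : ℂ}
    (hz : IsAlgebraic ℚ z) : ∃ w : AlgebraicClosure ℚ, σ w = z := by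
  haveI : Algebra.IsAlgebraic ℚ (AlgebraicClosure ℚ) := AlgebraicClosure.isAlgebraic ℚ
  haveI : IsAlgClosure ℚ (AlgebraicClosure ℚ) := AlgebraicClosure.instIsAlgClosure ℚ
  haveI : IsAlgClosure ℚ (algebraicClosure ℚ ℂ) := algebraicClosure.isAlgClosure ℚ ℂ
  let σ' : AlgebraicClosure ℚ →ₐ[ℚ] ℂ := σ.toRatAlgHom
  have hrange : ∀ w, σ' w ∈ (algebraicClosure ℚ ℂ).toSubalgebra := fun w =>
    mem_algebraicClosure_iff.2 ((Algebra.IsAlgebraic.isAlgebraic (R := ℚ) w).algHom σ')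
  let σ'' : AlgebraicClosure ℚ →ₐ[ℚ] algebraicClosure ℚ ℂ := σ'.codRestrict _ hrange
  let ε : algebraicClosure ℚ ℂ ≃ₐ[ℚ] AlgebraicClosure ℚ := IsAlgClosure.equiv ℚ _ _
  obtain ⟨w, hw⟩ := (Algebra.IsAlgebraic.algHom_bijective (ε.toAlgHom.comp σ'')).2
    (ε ⟨z, mem_algebraicClosure_iff.2 hz⟩)
  refine ⟨w, ?_⟩
  have h : σ'' w = ⟨z, mem_algebraicClosure_iff.2 hz⟩ := ε.injective hw
  exact congrArg Subtype.val h

/-- The subfield `ℚ̄ ⊆ ℂ` of algebraic numbers (`algebraicClosure ℚ ℂ`, as in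
`IsDefinedOverQbar`) is contained in — indeed equal to — the image of any embedding
`σ : AlgebraicClosure ℚ →+* ℂ`. [folklore] -/
theorem algebraicClosure_le_fieldRange (σ : AlgebraicClosure ℚ →+* ℂ) :
    (algebraicClosure ℚ ℂ).toSubfield ≤ σ.fieldRange := by
  intro z hz
  obtain ⟨w, rfl⟩ := exists_apply_eq_of_isAlgebraic σ
    (mem_algebraicClosure_iff.1 (show z ∈ algebraicClosure ℚ ℂ from hz))
  exact ⟨w, rfl⟩

/-- `ℚ̄ = AlgebraicClosure ℚ` is countable (an algebraic extension of the countable field `ℚ`;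
Mathlib `Algebra.IsAlgebraic.cardinalMk_le_max`). [folklore] -/
theorem cardinalMk_algebraicClosure_rat_le_aleph0 : #(AlgebraicClosure ℚ) ≤ ℵ₀ :=
  haveI : Algebra.IsAlgebraic ℚ (AlgebraicClosure ℚ) := AlgebraicClosure.isAlgebraic ℚ
  (Algebra.IsAlgebraic.cardinalMk_le_max ℚ (AlgebraicClosure ℚ)).trans (by simp)

/-! ### Complex points of `S₀ ⊗_σ ℂ` over the same point of `S₀` are Galois conjugate -/

variable {K : Type} [Field K] (σ : K →+* ℂ) (S₀ : Motives.SchemeOver K)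

/-- The point of `S₀` under a complex point `P` of `S = S₀ ⊗_{K,σ} ℂ` is the underlying point of
the `ℂ`-point of `S₀` (over `σ`) corresponding to `P` (`Motives.AlgPoints.baseChangeEquiv`).
[folklore] -/
theorem base_pt_eq_pt_baseChangeEquiv_symm (P : Motives.ComplexPoints ((Motives.baseChangeHom σ).obj S₀)) :
    (Motives.baseChangeHomFst σ S₀).base P.pt =
      (letI := σ.toAlgebra; ((Motives.AlgPoints.baseChangeEquiv σ S₀).symm P).pt) := by
  letI := σ.toAlgebra
  change _ = ((Motives.AlgPoints.baseChangeEquiv σ S₀).symm P).left.base (IsLocalRing.closedPoint ℂ)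
  rw [Motives.AlgPoints.baseChangeEquiv_symm_apply_left]
  rfl

/-- **Complex points of `S = S₀ ⊗_{K,σ} ℂ` lying over the same point of `S₀` are conjugate under
`Aut(ℂ/σK)`** (`K` countable, `S₀` locally of finite type over `K`): `t = τ · s`
(`HodgeTheory.conjPoint`) for some `τ`. Transport of `Motives.AlgPoints.exists_smul_eq_of_pt_eq`
through `S(ℂ) ≃ S₀(ℂ)`. [cite: Lang1958IAG, Ch. III §4] -/
theorem exists_conjPoint_eq_of_base_pt_eq (hK : #K ≤ ℵ₀) [LocallyOfFiniteType S₀.hom]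
    {s t : Motives.ComplexPoints ((Motives.baseChangeHom σ).obj S₀)}
    (h : (Motives.baseChangeHomFst σ S₀).base s.pt = (Motives.baseChangeHomFst σ S₀).base t.pt) :
    ∃ τ : ringAutOver σ, conjPoint σ S₀ τ s = t := by
  letI := σ.toAlgebra
  have hpt : ((Motives.AlgPoints.baseChangeEquiv σ S₀).symm t).pt =
      ((Motives.AlgPoints.baseChangeEquiv σ S₀).symm s).pt := by
    rw [← base_pt_eq_pt_baseChangeEquiv_symm, ← base_pt_eq_pt_baseChangeEquiv_symm]
    exact h.symm
  obtain ⟨τ, hτ⟩ := Motives.AlgPoints.exists_smul_eq_of_pt_eq hK _ _ hpt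
  refine ⟨τ, ?_⟩
  unfold conjPoint
  rw [hτ, Equiv.apply_symm_apply]

variable {σ S₀}

/-- **Sets defined over a subfield `k₀ ⊆ σ(K)` are saturated for `S(ℂ) → S₀`**: if `Z ⊆ S(ℂ)` is
defined over `k₀` (`IsDefinedOver`: Zariski closed on points and stable under the automorphisms of
`ℂ` over `K` fixing `k₀`) and contains `s`, it contains every complex point over the same point of
`S₀` as `s` — such a point is a conjugate `τ · s`, and `τ` fixes `k₀ ⊆ σ(K)` pointwise (`K`
countable, `S₀` locally of finite type). "A `k`-closed set contains, with a point, a complete set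
of its conjugates over `k`" (Lang, III §4–§5). [cite: Lang1958IAG, Ch. III §4] -/
theorem IsDefinedOver.mem_of_base_pt_eq (hK : #K ≤ ℵ₀) [LocallyOfFiniteType S₀.hom]
    {k₀ : Subfield ℂ} (hk₀ : k₀ ≤ σ.fieldRange)
    {Z : Set (Motives.ComplexPoints ((Motives.baseChangeHom σ).obj S₀))}
    (hZ : IsDefinedOver σ S₀ k₀ Z) {s t : Motives.ComplexPoints ((Motives.baseChangeHom σ).obj S₀)}
    (hs : s ∈ Z)
    (h : (Motives.baseChangeHomFst σ S₀).base s.pt = (Motives.baseChangeHomFst σ S₀).base t.pt) :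
    t ∈ Z := by
  obtain ⟨τ, rfl⟩ := exists_conjPoint_eq_of_base_pt_eq σ S₀ hK h
  refine hZ.2 τ (fun z hz => ?_) ⟨s, hs, rfl⟩
  obtain ⟨w, rfl⟩ := hk₀ hz
  letI := σ.toAlgebra
  exact τ.commutes w

/-- **Sets defined over `ℚ̄` are saturated for `S(ℂ) → S₀`** (`S₀` a `ℚ̄`-scheme locally of finite
type, `σ : ℚ̄ →+* ℂ`): a `ℚ̄`-defined `Z ⊆ S(ℂ)` (`IsDefinedOverQbar`) contains, with `s`, every
complex point over the same point of `S₀` (the automorphisms of `ℂ` over `σ(ℚ̄)` fix the algebraic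
numbers, `algebraicClosure_le_fieldRange`). [cite: Lang1958IAG, Ch. III §4] -/
theorem IsDefinedOverQbar.mem_of_base_pt_eq {σ : AlgebraicClosure ℚ →+* ℂ}
    {S₀ : Motives.SchemeOver (AlgebraicClosure ℚ)} [LocallyOfFiniteType S₀.hom]
    {Z : Set (Motives.ComplexPoints ((Motives.baseChangeHom σ).obj S₀))}
    (hZ : IsDefinedOverQbar σ S₀ Z) {s t : Motives.ComplexPoints ((Motives.baseChangeHom σ).obj S₀)}
    (hs : s ∈ Z)
    (h : (Motives.baseChangeHomFst σ S₀).base s.pt = (Motives.baseChangeHomFst σ S₀).base t.pt) :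
    t ∈ Z :=
  IsDefinedOver.mem_of_base_pt_eq cardinalMk_algebraicClosure_rat_le_aleph0
    (algebraicClosure_le_fieldRange σ) hZ hs h

end HodgeTheory

end Literature.AlgebraicGeometry.HodgeTheory


end
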